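/-
Origin: expansion seat `planner-pub-hodgecm-pv03-g8-0`, handover #4 2026-08-18T15:35:50Z (md5 373d6117; import rewrite ToyG5.HodgeRiemannGram3->HodgeCM.Model.ToyG2.HodgeRiemannGram3; land after toy-g5 t31 rows 1-3) (`HOME/pub-hodgecm-pv03-g8/lean/Pv03g8/ThetaModelEmb3.lean`, md5 373d6117, 288 lines);
landed by the gen-8 packager in gate run 31 as `HodgeCM/Model/ToyG2/ThetaModelEmb3.lean` (import ^import ToyG5\.HodgeRiemannGram3[ \t]*$→import HodgeCM.Model.ToyG2.HodgeRiemannGram3 ×1).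
-/
/-
Copyright: pub-hodgecm formalisation cell (harness21, 2026). New file (not vendored).
Origin: HOME/pub-hodgecm-pv03-g8/lean/Pv03g8/ThetaModelEmb3.lean — session planner-pub-hodgecm-pv03-g8-0
(unit pub-hodgecm-pv03-g8, DAG-NODE PROVER #03 gen 8), row #4.  Intended final place:
`HodgeCM/Model/ToyG2/ThetaModelEmb3.lean` (module `HodgeCM.Model.ToyG2.ThetaModelEmb3`; kind L5, consistency-witness layer).
ADDITIVE: nothing landed is edited; nothing imports it.  ONE import rewrite at landing:
`import ToyG5.HodgeRiemannGram3` ↦ `import HodgeCM.Model.ToyG2.HodgeRiemannGram3` (toy-g5 HANDOVER #4, RUN 31; land AFTER it).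
-/
import Mathlib
import Summits.HodgeConjecture.HodgeCM.Model.ToyG2.HodgeRiemannGram3
import Summits.HodgeConjecture.HodgeCM.Model.ToyG2.HodgeRiemann3
import Summits.HodgeConjecture.HodgeCM.Model.ToyG2.Isolation
import Summits.HodgeConjecture.HodgeCM.Model.ToyG2.CMInflation3
import Summits.HodgeConjecture.HodgeCM.PerL34.EndStateMinimal

/-!
# A theta model over the universe of record meeting the Matsushima-interface binders N09a/N09b — with periods

The END STATE of record (`PerL34.hcCM_of_openCharsWeilLeavesCRΔ_signRecipe_descentFactsB₄`, binder list `M` + 12 + 7)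
quantifies over a universe `U` AND a theta model `T : U.ThetaModel`.  The model-side census so far decided every
UNIVERSE-level binder in the universe of record `toyUniverse₃ d t` (`1 ≤ d`, `t² = 16`): `M`, the seven [QW8]-side facts
and M38 hold (`CMInflation3`), N07 `Fact_hodgeRiemann20` FAILS (`NoEndState3`, toy-g5 `HodgeRiemann3`).  Of the
`T`-level binders only RELATIVE or VACUOUS information existed: in every period-free shadow N07 and N09b die together
(pv01-g5 `EndStateShadow`/`EndStateBinderSep`), and pv03-g4's `T♯` meets N09b only with `emb = 0` over a period-free
universe (`tr = 0`: the Petersson identity `0 = c · 0`).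

This file builds the FIRST theta model over a universe WITH PERIODS meeting the two PRINT-interface binders about
`emb`/`cover` — N09a `Fact_embCover` and N09b `Fact_innerEmb` (Matsushima; [BW] VII 3.2: `⟨η, η'⟩ = c ∫ η ∧ η̄'` on
holomorphic 2-forms) — NON-VACUOUSLY, and records which further END-STATE binders it meets:

* `thetaModel₃ d t hd ht : (toyUniverse₃ d t).ThetaModel` — `HG := L²`-stand-in `ThetaUiso.HG L ι₁` (toy-g2/pv03-g5),
  **`emb Γ :=` toy-g5's Gram map `hr3g_Lam`** (`H²(P_Γ, ℂ) →ₗ HG`, `Lam (p ∪ q) = Λ(p, q)`), `cover := idMor`, theta one-forms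
  `Theta V c i Γ := U_iso(Γ; K, Ψᵢ, σ)` (all forms of type `Ψᵢ`), and the NULL analytic side (`lineCore 0`/`lineTorus 0` of
  toy-g2 `Isolation`: `H = ℂ`, `C([G_U]) := HG`, trivial groups, one allowed character);
* `thetaModel₃_embCover` — **N09a holds**; `thetaModel₃_innerEmb` — **N09b holds with `c = ¼`**:
  `⟪emb η', emb η⟫ = ¼ · tr_ℂ(η ∪ η̄')` on `F²H²(P_Γ)` (toy-g5 `hr3g_gram`);
* NON-VACUITY (`thetaModel₃_emb_theta23_ne_zero`, `thetaModel₃_petersson_ne_zero`, `thetaModel₃_exists_petersson_ne_zero`):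
  in EVERY block `k` of every period surface the `(2,0)`-class `E_{k,2} ∪ E_{k,3}` has `emb ≠ 0` and Petersson norm
  `tr_ℂ(η ∪ η̄) = 4‖Λ(E_{k,2}, E_{k,3})‖² ≠ 0`; such `(L, ι₁, V, Γ, η)` exist outright (toy2 `Inhabited`, Landherr, `LevelExists`);
* further END-STATE binders met by the same `T` (re-signed with PerL's recipe, `T.withSignRecipe h`, as the theorem of
  record states them): `hAlb` `Fact_thetaAlbanese` ([Liu21] interface; here with `M := K`, `k := id`), `hch` `Open_chars`,
  `Pc` (a `C4a.PointedCore` on the core: coordinate evaluations of `HG = ℓ²(HGIdx)` separate), and the old-list N12a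
  `Open_thetaSub`;
* `exists_thetaModel_innerEmb_not_hodgeRiemann20` — **CENSUS EDGE (absolute, with periods)**: there are `U`, `T` with
  `M ∧ N09a ∧ N09b (non-vacuous) ∧ hAlb ∧ hch ∧ Pc ∧ M38 ∧` the seven [QW8]-side facts `∧ U.PerL ∧ U.HC_CM ∧ ¬ N07`.
  So N07 is independent of `M` + N09a + N09b + M38 + the [QW8] side even in the presence of genuine periods and of the
  Petersson = period identity: what fails is DEFINITENESS only (toy-g5: HR20 fails exactly on the radical of `tr ∘ ∪`,
  where `Lam` vanishes — `hr3g_radical_iff_Lam_eq_zero`).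

NOT EXAMINED here (stated for the successor, not claimed): the dictionary binders `hbr`/`hQ` (`SeesawBridge`/`QautBridge`),
the archimedean data `A12`/`A34` (`ArchCDatum`) and `hW` (`CharSpansFinal.WeilStepsInputCRΔ`) — they concern the analytic
side, which is null in `thetaModel₃`.  Nothing cited, nothing posited, no unfinished proofs.
-/

open scoped TensorProduct InnerProductSpace
open HodgeCM.Toy HodgeCM.Toy.CMPresentation exteriorPower NumberField.ComplexEmbedding
open Literature.AlgebraicGeometry.Motives
open Literature.AlgebraicGeometry.Motives.HodgeStructure (conj)
open HodgeCM.Prior.Perl34File HodgeCM.Prior.Perl34File.Perl34 HodgeCM.CMTypeOps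

namespace HodgeCM.ToyG2

open ThetaUiso HodgeCM.Universe HodgeCM.Universe.ThetaModel HodgeCM.PerL34

noncomputable section

section Model

variable (d t : ℚ) (hd : (1 : ℚ) ≤ d) (ht : t ^ 2 = 16)

/-- **The theta model of record over `toyUniverse₃ d t`**: `emb :=` the Gram map `hr3g_Lam` (toy-g5), `cover := id`,
theta one-forms `:= U_iso`, null analytic side (`lineCore 0`, `lineTorus 0`). The sign data `kappa`/`frameSign` are
placeholders (the end state re-signs every model with PerL's recipe, `T.withSignRecipe h`). -/
def thetaModel₃ : (toyUniverse₃ d t).ThetaModel where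
  HG := fun L ι₁ _ => HG L ι₁
  instHG₁ := fun _ _ _ => inferInstance
  instHG₂ := fun _ _ _ => inferInstance
  instHG₃ := fun _ _ _ => inferInstance
  emb := fun {_} {ι₁} {_} Γ => hr3g_Lam d t ι₁ Γ hd ht
  cover := fun Γ _ _ => (toyUniverse₃ d t).idMor ((toyUniverse₃ d t).pms _ _ _ Γ)
  kappa := fun _ _ j _ τ => τ.comp j
  frameSign := fun _ _ _ => true
  H := fun _ _ => ℂ
  CG := fun {L} {ι₁} _ _ => HG L ι₁
  G := fun _ _ => Unit
  SK := fun _ _ => Unit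
  SigIdx := fun _ _ => Unit
  SigIdxG := fun _ _ => Unit
  instH₁ := fun _ _ => inferInstance
  instH₂ := fun _ _ => inferInstance
  instH₃ := fun _ _ => inferInstance
  instCG₁ := fun _ _ => inferInstance
  instCG₂ := fun _ _ => inferInstance
  instG₁ := fun _ _ => inferInstance
  instG₂ := fun _ _ => inferInstance
  instSK := fun _ _ => inferInstance
  core := fun {L} {ι₁} _ _ => lineCore (0 : HG L ι₁)
  t12 := fun {L} {ι₁} _ _ => lineTorus (0 : HG L ι₁)
  t34 := fun {L} {ι₁} _ _ => lineTorus (0 : HG L ι₁)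
  Theta := fun V c i Γ =>
    ((toyUniverse₃ d t).Uiso Γ c.K (c.Ψ i) c.σ : Set ((toyUniverse₃ d t).CohC ((toyUniverse₃ d t).pms _ _ V Γ) 1))

variable {L : CMField} (ι₁ : L →+* ℂ) {V : HermSpace3 L ι₁}

/-- `emb Γ` is the Gram map -/
theorem thetaModel₃_emb (Γ : Level V) : (thetaModel₃ d t hd ht).emb Γ = hr3g_Lam d t ι₁ Γ hd ht := rfl

/-- the model's wedge-function `Λ_T(ω, ω') = emb(ω ∪ ω')` is the Gram bilinear map `Λ` of `ThetaGram` -/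
theorem thetaModel₃_Λ (Γ : Level V) (ω ω' : (toyUniverse₃ d t).CohC ((toyUniverse₃ d t).pms L ι₁ V Γ) 1) :
    (thetaModel₃ d t hd ht).Λ Γ ω ω' = Λ ι₁ d t hd ht ω ω' :=
  hr3g_Lam_cup d t ι₁ Γ hd ht ω ω'

/-- pull-back of degree-two classes along the identity of the period surface is the identity -/
theorem pullC_idMor_pms₃_two (Γ Γ' : Level V) (η : (toyUniverse₃ d t).CohC ((toyUniverse₃ d t).pms L ι₁ V Γ) 2) :
    (toyUniverse₃ d t).pullC (X := (toyUniverse₃ d t).pms L ι₁ V Γ') (Y := (toyUniverse₃ d t).pms L ι₁ V Γ)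
        ((toyUniverse₃ d t).idMor ((toyUniverse₃ d t).pms L ι₁ V Γ)) 2 η = η := by
  have h : (toyUniverse₃ d t).pull ((toyUniverse₃ d t).idMor ((toyUniverse₃ d t).pms L ι₁ V Γ)) 2
      = LinearMap.id :=
    fact3_pull_id exteriorHodgeData traceSys (gplOf d t) _ 2
  show ((toyUniverse₃ d t).pull ((toyUniverse₃ d t).idMor ((toyUniverse₃ d t).pms L ι₁ V Γ)) 2).baseChange ℂ η = η
  rw [h, LinearMap.baseChange_id, LinearMap.id_apply]

/-- **N09a `Fact_embCover` holds for `thetaModel₃`.** -/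
theorem thetaModel₃_embCover : N09a_embCover (thetaModel₃ d t hd ht) := by
  intro L ι₁ V Γ Γ' h η
  show hr3g_Lam d t ι₁ Γ' hd ht ((toyUniverse₃ d t).pullC (X := (toyUniverse₃ d t).pms L ι₁ V Γ')
    (Y := (toyUniverse₃ d t).pms L ι₁ V Γ) ((toyUniverse₃ d t).idMor ((toyUniverse₃ d t).pms L ι₁ V Γ)) 2 η)
      = hr3g_Lam d t ι₁ Γ hd ht η
  rw [pullC_idMor_pms₃_two]
  rfl

/-- **N09b `Fact_innerEmb` holds for `thetaModel₃`, with the constant `c = ¼`** (toy-g5's Gram identity `hr3g_gram`). -/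
theorem thetaModel₃_innerEmb : N09b_innerEmb (thetaModel₃ d t hd ht) := by
  intro L ι₁ V Γ
  refine ⟨(1 / 4 : ℂ), by norm_num, fun η η' hη hη' => ?_⟩
  show ⟪hr3g_Lam d t ι₁ Γ hd ht η', hr3g_Lam d t ι₁ Γ hd ht η⟫_ℂ = _
  rw [hr3g_gram d t ι₁ Γ hd ht hη hη']
  ring

/-- the same two binders for the re-signed model (the statements are literally the same) -/
theorem thetaModel₃_embCover_signRecipe (h : Bool) : N09a_embCover ((thetaModel₃ d t hd ht).withSignRecipe h) :=
  thetaModel₃_embCover d t hd ht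

/-- (Ported verbatim from the HodgeCMPerL package; no docstring in the source.) -/
theorem thetaModel₃_innerEmb_signRecipe (h : Bool) : N09b_innerEmb ((thetaModel₃ d t hd ht).withSignRecipe h) :=
  thetaModel₃_innerEmb d t hd ht

/-! ### Non-vacuity: nonzero Petersson norms in every block -/

/-- the `(2,0)`-class `E_{k,2,θ} ∪ E_{k,3,θ}` of block `k` (`θ = ι₁ ∘ eK⁻¹`) -/
def theta23Cls₃ (k : Fin (nQ L ι₁)) (Γ : Level V) : (toyUniverse₃ d t).CohC ((toyUniverse₃ d t).pms L ι₁ V Γ) 2 :=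
  (toyUniverse₃ d t).cup2C ((toyUniverse₃ d t).pms L ι₁ V Γ) 1
    (eCls ι₁ d t k 2 (embOf L ι₁)) (eCls ι₁ d t k 3 (embOf L ι₁))

/-- (Ported verbatim from the HodgeCMPerL package; no docstring in the source.) -/
theorem theta23Cls₃_mem_F2 (k : Fin (nQ L ι₁)) (Γ : Level V) :
    theta23Cls₃ d t ι₁ k Γ ∈ ((toyUniverse₃ d t).hodge ((toyUniverse₃ d t).pms L ι₁ V Γ) 2).F 2 :=
  Universe.cup2C_mem_F2 (toyUniverse₃_modelAxioms_all d t) _ (hr3_eCls_mem_H10 d t ι₁ Γ k 2)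
    (hr3_eCls_mem_H10 d t ι₁ Γ k 3)

/-- **`emb` does not vanish** on the theta `(2,0)`-class of any block (`ThetaGram`'s non-vanishing `Λ_theta23_ne_zero`). -/
theorem thetaModel₃_emb_theta23_ne_zero (k : Fin (nQ L ι₁)) (Γ : Level V) :
    (thetaModel₃ d t hd ht).emb Γ (theta23Cls₃ d t ι₁ k Γ) ≠ 0 := by
  show hr3g_Lam d t ι₁ Γ hd ht _ ≠ 0
  rw [theta23Cls₃, hr3g_Lam_cup]
  exact Λ_theta23_ne_zero ι₁ d t k hd ht (hr3_embOf_hol ι₁ k 0) (hr3_embOf_hol ι₁ k 1) (hr3_embOf_hol ι₁ k 2)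
    (hr3_embOf_hol ι₁ k 3)

include hd ht in
/-- **nonzero Petersson norm**: `tr_ℂ(η ∪ η̄) = 4‖Λ(E_{k,2}, E_{k,3})‖² ≠ 0` for `η = E_{k,2} ∪ E_{k,3}` — the identity of
N09b is exercised on classes with nonzero periods. -/
theorem thetaModel₃_petersson_ne_zero (k : Fin (nQ L ι₁)) (Γ : Level V) :
    (toyUniverse₃ d t).trC ((toyUniverse₃ d t).pms L ι₁ V Γ) 4
        ((toyUniverse₃ d t).cup2C ((toyUniverse₃ d t).pms L ι₁ V Γ) 2 (theta23Cls₃ d t ι₁ k Γ)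
          (conj (theta23Cls₃ d t ι₁ k Γ))) ≠ 0 := by
  rw [hr3g_gram d t ι₁ Γ hd ht (theta23Cls₃_mem_F2 d t ι₁ k Γ) (theta23Cls₃_mem_F2 d t ι₁ k Γ)]
  exact mul_ne_zero (by norm_num) (inner_self_ne_zero.mpr (thetaModel₃_emb_theta23_ne_zero d t hd ht ι₁ k Γ))

/-- non-vacuity of N09b, block-wise: every block carries a `(2,0)`-class with `emb ≠ 0` and nonzero Petersson norm -/
theorem thetaModel₃_innerEmb_nonvacuous (k : Fin (nQ L ι₁)) (Γ : Level V) :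
    ∃ η ∈ ((toyUniverse₃ d t).hodge ((toyUniverse₃ d t).pms L ι₁ V Γ) 2).F 2,
      (thetaModel₃ d t hd ht).emb Γ η ≠ 0 ∧
        (toyUniverse₃ d t).trC ((toyUniverse₃ d t).pms L ι₁ V Γ) 4
          ((toyUniverse₃ d t).cup2C ((toyUniverse₃ d t).pms L ι₁ V Γ) 2 η (conj η)) ≠ 0 :=
  ⟨theta23Cls₃ d t ι₁ k Γ, theta23Cls₃_mem_F2 d t ι₁ k Γ, thetaModel₃_emb_theta23_ne_zero d t hd ht ι₁ k Γ,
    thetaModel₃_petersson_ne_zero d t hd ht ι₁ k Γ⟩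

/-- **non-vacuity, outright**: some period surface of `toyUniverse₃ d t` carries a `(2,0)`-class with `emb ≠ 0` and nonzero
Petersson norm (a CM field with two blocks: toy2 `Inhabited`; a hermitian space: Landherr; a level: `LevelExists`). -/
theorem thetaModel₃_exists_petersson_ne_zero :
    ∃ (F : CMField) (ι₁ : F →+* ℂ) (V : HermSpace3 F ι₁) (Γ : Level V)
      (η : (toyUniverse₃ d t).CohC ((toyUniverse₃ d t).pms F ι₁ V Γ) 2),
      η ∈ ((toyUniverse₃ d t).hodge ((toyUniverse₃ d t).pms F ι₁ V Γ) 2).F 2 ∧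
        (thetaModel₃ d t hd ht).emb Γ η ≠ 0 ∧
          (toyUniverse₃ d t).trC ((toyUniverse₃ d t).pms F ι₁ V Γ) 4
            ((toyUniverse₃ d t).cup2C ((toyUniverse₃ d t).pms F ι₁ V Γ) 2 η (conj η)) ≠ 0 := by
  obtain ⟨F, ι₁, k, -, -⟩ := hr3_exists_two_blocks
  obtain ⟨V⟩ := landherr_exists_proof F ι₁
  obtain ⟨Γ⟩ := Level.nonempty V
  obtain ⟨η, hF, hne, htr⟩ := thetaModel₃_innerEmb_nonvacuous d t hd ht ι₁ (V := V) k Γ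
  exact ⟨F, ι₁, V, Γ, η, hF, hne, htr⟩

/-! ### Further END-STATE binders met by `thetaModel₃` -/

/-- **`Pc`: a pointed core** on the (null) core — points `:= HGIdx`, evaluation `:=` the coordinate functionals of
`HG = ℓ²(HGIdx)`, which separate. -/
def thetaModel₃_pointedCore (V : HermSpace3 L ι₁) (c : SeesawCtx L) :
    C4a.PointedCore ((thetaModel₃ d t hd ht).core V c) where
  Pt := HGIdx L ι₁
  evalPt := fun p => EuclideanSpace.proj p
  evalPt_sep := fun φ hφ => by
    refine PiLp.ext (fun p => ?_)
    exact hφ p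

/-- the same for the re-signed model (its core is the same, definitionally) -/
def thetaModel₃_pointedCore_signRecipe (h : Bool) (V : HermSpace3 L ι₁) (c : SeesawCtx L) :
    C4a.PointedCore (((thetaModel₃ d t hd ht).withSignRecipe h).core V c) :=
  thetaModel₃_pointedCore d t hd ht ι₁ V c

/-- **`hch` `Open_chars`** for the re-signed model: the single character of `lineTorus` is allowed. -/
theorem thetaModel₃_openChars_signRecipe (h : Bool) : ((thetaModel₃ d t hd ht).withSignRecipe h).Open_chars :=
  fun _ _ _ => ⟨fun _ => trivial, fun _ => trivial⟩

/-- (Ported verbatim from the HodgeCMPerL package; no docstring in the source.) -/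
theorem thetaModel₃_openChars : (thetaModel₃ d t hd ht).Open_chars :=
  fun _ _ _ => ⟨fun _ => trivial, fun _ => trivial⟩

/-- **`hAlb` `Fact_thetaAlbanese`** for the re-signed model: with `Theta := U_iso(Γ; K, Ψᵢ, σ)` take `M := K`, `k := id`,
`σ' := σ` (`inflate id Ψ = Ψ`). -/
theorem thetaModel₃_thetaAlbanese_signRecipe (h : Bool) :
    ((thetaModel₃ d t hd ht).withSignRecipe h).Fact_thetaAlbanese := by
  intro L ι₁ V c _ i Γ
  refine ⟨c.K, RingHom.id _, c.σ, RingHom.comp_id _, ?_⟩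
  rw [inflate_id]
  exact subset_rfl

/-- (Ported verbatim from the HodgeCMPerL package; no docstring in the source.) -/
theorem thetaModel₃_thetaAlbanese : (thetaModel₃ d t hd ht).Fact_thetaAlbanese := by
  intro L ι₁ V c _ i Γ
  refine ⟨c.K, RingHom.id _, c.σ, RingHom.comp_id _, ?_⟩
  rw [inflate_id]
  exact subset_rfl

/-- the old-list node N12a `Open_thetaSub` (theta forms lie in `U_iso`) — by construction -/
theorem thetaModel₃_openThetaSub_signRecipe (h : Bool) : ((thetaModel₃ d t hd ht).withSignRecipe h).Open_thetaSub :=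
  fun _ _ _ _ _ => subset_rfl

/-- (Ported verbatim from the HodgeCMPerL package; no docstring in the source.) -/
theorem thetaModel₃_openThetaSub : (thetaModel₃ d t hd ht).Open_thetaSub :=
  fun _ _ _ _ _ => subset_rfl

end Model

/-! ### The census edge -/

/-- **CENSUS EDGE — N07 is independent of `M` + N09a + N09b + `hAlb` + `hch` + `Pc` + M38 + the [QW8] side, ABSOLUTELY and
WITH PERIODS.**  Witness: `toyUniverse₃ 1 4` with `thetaModel₃ 1 4`; N09b holds non-vacuously (a `(2,0)`-class with
`emb ≠ 0` and nonzero Petersson norm exists), the conclusions `PerL`, `HC_CM` hold, and N07 fails. -/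
theorem exists_thetaModel_innerEmb_not_hodgeRiemann20 :
    ∃ (U : Universe) (T : U.ThetaModel), U.ModelAxioms ∧ N09a_embCover T ∧ N09b_innerEmb T ∧
      (∃ (F : CMField) (ι₁ : F →+* ℂ) (V : HermSpace3 F ι₁) (Γ : Level V) (η : U.CohC (U.pms F ι₁ V Γ) 2),
        η ∈ (U.hodge (U.pms F ι₁ V Γ) 2).F 2 ∧ T.emb Γ η ≠ 0 ∧
          U.trC (U.pms F ι₁ V Γ) 4 (U.cup2C (U.pms F ι₁ V Γ) 2 η (conj η)) ≠ 0) ∧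
      (∀ h : Bool, (T.withSignRecipe h).Fact_thetaAlbanese ∧ (T.withSignRecipe h).Open_chars ∧
        ∀ {L : CMField} {ι₁ : L →+* ℂ} (V : HermSpace3 L ι₁) (c : SeesawCtx L),
          Nonempty (C4a.PointedCore ((T.withSignRecipe h).core V c))) ∧
      U.Fact_cmInflation ∧
      (U.Fact_cupExterior ∧ U.Fact_cup_hodge ∧ U.Fact_cupAlg ∧ U.Fact_cupAssoc ∧ U.Fact_unitH0 ∧
        U.Fact_gysinDescentB ∧ U.Fact_dimProd) ∧
      U.PerL ∧ U.HC_CM ∧ ¬ N07_hodgeRiemann20 U := by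
  obtain ⟨hM, h1, h2, h4, h5, hu, hb, hdp, h38⟩ := toyUniverse₃_endToEnd_universeLevel 1 4 le_rfl (by norm_num)
  obtain ⟨-, -, ⟨-, -, -, -, -, -⟩, hHC, hP, -⟩ := toyUniverse₃_profile_all 1 4 le_rfl (by norm_num)
  refine ⟨toyUniverse₃ 1 4, thetaModel₃ 1 4 le_rfl (by norm_num), hM,
    thetaModel₃_embCover 1 4 le_rfl (by norm_num), thetaModel₃_innerEmb 1 4 le_rfl (by norm_num),
    thetaModel₃_exists_petersson_ne_zero 1 4 le_rfl (by norm_num),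
    fun h => ⟨thetaModel₃_thetaAlbanese_signRecipe 1 4 le_rfl (by norm_num) h,
      thetaModel₃_openChars_signRecipe 1 4 le_rfl (by norm_num) h,
      fun V c => ⟨thetaModel₃_pointedCore_signRecipe 1 4 le_rfl (by norm_num) _ h V c⟩⟩,
    h38, ⟨h1, h2, h4, h5, hu, hb, hdp⟩, hP, hHC, ?_⟩
  rw [N07_iff]
  exact not_toyUniverse₃_hodgeRiemann20 1 4

/-- hence: `M` + N09a + N09b + M38 + the seven [QW8]-side facts do NOT imply N07 (for any convention bit) -/
theorem not_imp_hodgeRiemann20_of_innerEmb :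
    ¬ ∀ (U : Universe) (T : U.ThetaModel), U.ModelAxioms → N09a_embCover T → N09b_innerEmb T →
      U.Fact_cmInflation → N07_hodgeRiemann20 U := by
  intro hall
  obtain ⟨U, T, hM, h9a, h9b, -, -, h38, -, -, -, h07⟩ := exists_thetaModel_innerEmb_not_hodgeRiemann20
  exact h07 (hall U T hM h9a h9b h38)

end

end HodgeCM.ToyG2
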